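import Summits.QuantumFields.BalabanUV.Beta.GAN24.TransportedWordReduction
import Summits.QuantumFields.BalabanUV.Beta.GAN24.VHWordsZeroLatticeStep
import Summits.QuantumFields.BalabanUV.Beta.GAN24.CombTransportedBorder

/-!
# `BalabanUV.Beta.GAN24.CombVHEWordsZero` — binder row G-an2-4 ∕ (CONV-C), TRANSFER-III, the (III′) (C)-campaign's supplier `hB0`, **(24) AT THE COMB DATA, LEVEL `0`, UNCONDITIONALLY**
# (leaf-01 g85 `README-g85` «LOCATED» (24)_comb): **THE `VH′_c ⊗ E′_{u′}` WORD AND ITS SWAP OF THE bm-CHART FORCING ON TRANSPORTED TABLES VANISH, BOND BY BOND** — the E-sector being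
# the transported Wilson table `𝒯(cE • wilsonA)`, the border sector ANY transported local table `𝒯S′` without field–field block (at an1's record `S′ = c • symVhSAt ρ_c`):
# `TransportedWordReduction` with the (E) chain's level-`0` current — `Lc`-periodic by block covariance, killed by the multiplier rows of `X̃♮_0` (fact (d1)
# `DressedKernelOnFaceCurrent.tsum_dressedStep_zero_inr_mul_halfVertex_snd`; the degenerate axis by `DressedWilsonHalfVertexAnyAxis.tsum_faceHalfVertex_snd_diag`)
# (G-an2-4 CRUX TEAM (2), leaf prover `b2b-balaban-gan24-formalise-leaf-01`, gen 86; journal [LEAF01-G86-INTENT-1])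

NOT IN PRINT; OUR BOOKKEEPING ([folklore] BY NAME over `TransportedWordReduction` (gen 86), leaf-04's `VHWordsZeroLatticeStep` (`tsum_current_periodic`, `current_bounded`), `EEWordReduced`
(`shiftK_dressedStep`, `unitS_wilsonA_translate`), `ExchangeFieldLegs.tsum_prod_faceHalfVertex`, `DressedKernelOnFaceCurrent` (d1), `DressedWilsonHalfVertexAnyAxis`, an2's `vertexOfK_translate`,
an3's `StepJetData` (`wilsonA`, `wilsonA_antisymm`, `locStencil_wilsonA`), leaf-01 g85 F3 `CombTransportedBorder` (`locStencil_symVhS`, `symVhS_inl_inl`); 0 `def`, 0 cited fact,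
0 `def … : Prop`, 0 sorry).
HONEST FRAMING (cell contract, verbatim): «discharging `BetaPertH` makes Bałaban's UV stability UNCONDITIONAL — a real constructive-QFT result; it is NOT the continuum limit and NOT
the Clay problem.»  HONEST DEPENDENCY (verbatim): «continuum YM on T⁴ ⇐ BetaPertH ∧ nine spine estimates (0/9 proved); BetaPertH ⇐ (D1) ∧ (D4) ∧ CAP+tail; G-an2-4 gates asym, D1
and NE2/3/4.»

## What is proved (generic `d`, `[NeZero Lc]`, `1 ≤ Lc`, in-block kernel root `toSite rb`, transport root `r ∈ box`, all units `s_f s_m`, any `cE`, any axes `μ ν α β`)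
* §1 the level-`j` Wilson current in product form: `wilsonCurrent_periodic` (`Lc`-periodic in its site, every `j`), **`tsum_dressedStep_zero_inr_mul_wilsonCurrent`** (killed by the
  multiplier rows of `X̃♮_0`, EVERY pair of axes — (d1) for `ν ≠ β`, the diagonal current is `0`), `wilson_inr_inl` ∕ `wilson_antisymm` (the two structural facts of the table).
* §2 LEVEL `0`, ANY TRANSPORT ROOT, ANY BORDER `S′` WITHOUT ff BLOCK: **`tsum_transported_noFF_wilson_word_eq_zero`** (`Σ'_{u′} FF[(vertexOfK X̃♮_0 Lc (unitS (𝒯S′)) μ c ∘ X̃♮_0) ∘ vertexOfK X̃♮_0 Lc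
  (unitS (𝒯(cE•wilsonA))) ν u′] = 0`), **`tsum_transported_wilson_noFF_word_eq_zero`** (the swap), `sum_box_transported_noFF_wilson_words_eq_zero` (both cell-and-lattice sums).
* §3 AT THE COMB DATA (`r = rb = ctrOff (d+1) Lc`, kernel root `ctr (d+1) Lc = ρ_c`, an1's border `S′ = c • symVhSAt ρ_c`, any `c` — at level `0` of the comb tower `c = cVH`):
  **`sum_box_comb_symVhS_wilson_words_zero_eq_zero`** — the `VH′ ⊗ E′` direct and swap words of 33_0 at the comb data (F6 `dM_comb_zero_split`'s `V^{E,0}′`, `V^VH′`) vanish, every period `N`.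
WHAT THIS IS NOT: levels `j ≥ 1` at the comb data need (D)∕(Z) of the UNTRANSPORTED comb E-sector's current and the parity of the comb member (NOT here); (27)_comb (`E′_c ⊗ VH′_{u′}`) and
`E ⊗ E` are NOT treated; NO value; NOT `hB0`; NEVER «G-an2-4 closed» as (CONV-C); NOT D1, NOT `BetaPertH`, NOT continuum, NOT Clay.  2026-08-27; no existing file touched.
-/

noncomputable section

open Finset
open scoped BigOperators
open Literature.MathematicalPhysics.QuantumFieldTheory
open Literature.MathematicalPhysics.QuantumFieldTheory.Balaban1983to89
open Literature.MathematicalPhysics.QuantumFieldTheory.Balaban1983to89.Beta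
open ExpKernelCalculus (Site MKer comp)
open AffineAveraging (box toSite)
open AveragingContoursRooted (ctr ctrOff ctrOff_mem_box)
open OneStepResolventKernel (Fib LocStencil)
open OneStepKernelFamily (KInvStep vertexOfK vertexOfK_translate)
open StepJetData (wilsonA locStencil_wilsonA wilsonA_antisymm locStencil_smul)
open Summit.QuantumFields.BalabanUV.Beta.SymAveragingHessianCounts (symVhSAt)
open Summit.QuantumFields.BalabanUV.Beta.TameKernelCalculus (trK)
open Summit.QuantumFields.BalabanUV.Beta.AxialDressingRooted (coDressKBmAt)
open Summit.QuantumFields.BalabanUV.Beta.HessKerDressedUnits (unitK unitS)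
open Summit.QuantumFields.BalabanUV.Beta.SymCorrectorKernel (psiKS)
open Summit.QuantumFields.BalabanUV.Beta.SymCorrectorFace (slotPsiS)
open Summit.QuantumFields.BalabanUV.Beta.GAN24.ExchangeSlotResum (face_weight_periodic)
open Summit.QuantumFields.BalabanUV.Beta.GAN24.ExchangeFieldLegs (tsum_prod_faceHalfVertex)
open Summit.QuantumFields.BalabanUV.Beta.GAN24.DressedKernelOnFaceCurrent (tsum_dressedStep_zero_inr_mul_halfVertex_snd)
open Summit.QuantumFields.BalabanUV.Beta.GAN24.DressedWilsonHalfVertexAnyAxis (tsum_faceHalfVertex_snd_diag)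
open Summit.QuantumFields.BalabanUV.Beta.GAN24.EEWordReduced (shiftK_dressedStep unitS_wilsonA_translate)
open Summit.QuantumFields.BalabanUV.Beta.GAN24.VHWordsZeroLatticeStep (tsum_current_periodic current_bounded)
open Summit.QuantumFields.BalabanUV.Beta.GAN24.CombTransportedBorder (pos_Lc locStencil_symVhS symVhS_inl_inl)
open Summit.QuantumFields.BalabanUV.Beta.GAN24.TransportedWordReduction (tsum_transported_direct_word_eq_zero_of_current tsum_transported_swap_word_eq_zero_of_current)

namespace Summit.QuantumFields.BalabanUV.Beta.GAN24.CombVHEWordsZero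

variable {d : ℕ} {Lc : ℕ} [NeZero Lc] {rb r : Fin (d + 1) → ℕ}

/-! ## §1 The bond-resummed exit-face current of the dressed Wilson vertex, in product form -/

section Current

/-- [folklore] **THE PRODUCT-FORM WILSON CURRENT IS `Lc`-PERIODIC IN ITS SITE** (every `j`, any slot axis `ν`, any face direction `γ`, any legs): the dressed Wilson vertex family is
block-covariant (an2's `vertexOfK_translate` with `EEWordReduced.shiftK_dressedStep ∕ unitS_wilsonA_translate`) and leaf-04's `tsum_current_periodic` applies. -/
theorem wilsonCurrent_periodic (hLc : 1 ≤ Lc) (sf sm cE : ℝ) (j : ℕ) (ν γ : Fin (d + 1)) (f g : Fib d) (z s : Site (d + 1)) :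
    ∑' uw : Site (d + 1) × Site (d + 1), (if uw.2 γ % (Lc : ℤ) = (Lc : ℤ) - 1 then (1 : ℝ) else 0) *
        vertexOfK (unitK sf sm (coDressKBmAt (toSite rb) Lc (KInvStep (d := d) Lc j))) Lc (unitS sf sm (fun κ v => cE • wilsonA d κ v)) ν uw.1 (z + (Lc : ℤ) • s) uw.2 f g
      = ∑' uw : Site (d + 1) × Site (d + 1), (if uw.2 γ % (Lc : ℤ) = (Lc : ℤ) - 1 then (1 : ℝ) else 0) *
        vertexOfK (unitK sf sm (coDressKBmAt (toSite rb) Lc (KInvStep (d := d) Lc j))) Lc (unitS sf sm (fun κ v => cE • wilsonA d κ v)) ν uw.1 z uw.2 f g :=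
  tsum_current_periodic (Lc := Lc) (R := vertexOfK (unitK sf sm (coDressKBmAt (toSite rb) Lc (KInvStep (d := d) Lc j))) Lc (unitS sf sm (fun κ v => cE • wilsonA d κ v)) ν)
    (fun u s' => vertexOfK_translate (N := Lc) (shiftK_dressedStep (r := rb) hLc sf sm j) (unitS_wilsonA_translate (d := d) sf sm cE) ν u s')
    (ρ := fun w : Site (d + 1) => if w γ % (Lc : ℤ) = (Lc : ℤ) - 1 then (1 : ℝ) else 0) (fun w s' => face_weight_periodic Lc γ w s') f g z s

/-- NOT IN PRINT; OUR BOOKKEEPING ([folklore]).  **THE MULTIPLIER ROWS OF `X̃♮_0` KILL THE PRODUCT-FORM WILSON CURRENT, FOR EVERY PAIR OF AXES** (in-block kernel root, `1 ≤ Lc`, all units):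
for `ν ≠ β` this is (d1) `DressedKernelOnFaceCurrent.tsum_dressedStep_zero_inr_mul_halfVertex_snd` (nested form by `ExchangeFieldLegs.tsum_prod_faceHalfVertex`); for `ν = β` the current
itself is `0` (`DressedWilsonHalfVertexAnyAxis.tsum_faceHalfVertex_snd_diag`). -/
theorem tsum_dressedStep_zero_inr_mul_wilsonCurrent (hLc : 1 ≤ Lc) (hrb : rb ∈ box (d + 1) Lc) (sf sm cE : ℝ) (ν β : Fin (d + 1)) (y₁ : Site (d + 1)) (m : Fin (d + 1)) :
    ∑' z : Site (d + 1), ∑ b : Fin (d + 1), unitK sf sm (coDressKBmAt (toSite rb) Lc (KInvStep (d := d) Lc 0)) y₁ z (Sum.inr m) (Sum.inl b) *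
        (∑' uw : Site (d + 1) × Site (d + 1), (if uw.2 β % (Lc : ℤ) = (Lc : ℤ) - 1 then (1 : ℝ) else 0) *
          vertexOfK (unitK sf sm (coDressKBmAt (toSite rb) Lc (KInvStep (d := d) Lc 0))) Lc (unitS sf sm (fun κ v => cE • wilsonA d κ v)) ν uw.1 z uw.2 (Sum.inl b) (Sum.inl β)) = 0 := by
  by_cases hνβ : ν = β
  · subst hνβ
    have h0 : ∀ (z : Site (d + 1)) (b : Fin (d + 1)), (∑' uw : Site (d + 1) × Site (d + 1), (if uw.2 ν % (Lc : ℤ) = (Lc : ℤ) - 1 then (1 : ℝ) else 0) *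
        vertexOfK (unitK sf sm (coDressKBmAt (toSite rb) Lc (KInvStep (d := d) Lc 0))) Lc (unitS sf sm (fun κ v => cE • wilsonA d κ v)) ν uw.1 z uw.2 (Sum.inl b) (Sum.inl ν)) = 0 :=
      fun z b => by rw [tsum_prod_faceHalfVertex hLc hrb sf sm cE 0 ν ν z b, tsum_faceHalfVertex_snd_diag hLc hrb sf sm cE 0 b z]
    simp only [h0, mul_zero, Finset.sum_const_zero, tsum_zero]
  · simp only [tsum_prod_faceHalfVertex hLc hrb sf sm cE 0 ν β]
    exact tsum_dressedStep_zero_inr_mul_halfVertex_snd hνβ hLc hrb sf sm cE y₁ m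

omit [NeZero Lc] in
/-- [folklore] The Wilson table has no `(inr, inl)` block (an3's `wilsonA`, by `rfl`). -/
theorem wilson_inr_inl (cE : ℝ) (γ : Fin (d + 1)) (κ' : Fin (d + 1)) (t x z : Site (d + 1)) (m : Fin (d + 1)) :
    (fun κ v => cE • wilsonA d κ v) κ' t x z (Sum.inr m) (Sum.inl γ) = 0 := by
  simp only [Pi.smul_apply, smul_eq_mul]
  rw [show wilsonA d κ' t x z (Sum.inr m) (Sum.inl γ) = 0 from rfl, mul_zero]

omit [NeZero Lc] in
/-- [folklore] The Wilson table is antisymmetric under the exchange of its two legs (an3's `wilsonA_antisymm`). -/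
theorem wilson_antisymm (cE : ℝ) (κ' : Fin (d + 1)) (u x z : Site (d + 1)) (a b : Fib d) :
    (fun κ v => cE • wilsonA d κ v) κ' u z x b a = -(fun κ v => cE • wilsonA d κ v) κ' u x z a b := by
  simp only [Pi.smul_apply, smul_eq_mul]
  rw [wilsonA_antisymm]
  ring

end Current

/-! ## §2 Level `0`: the words over a transported border and the transported Wilson table vanish -/

section LevelZero

variable {S' : Fin (d + 1) → Site (d + 1) → MKer (d + 1) (Fib d)} {Cs δs : ℝ} {μ ν α β : Fin (d + 1)}

/-- NOT IN PRINT; OUR BOOKKEEPING ([folklore]; (24) AT THE COMB DATA, LEVEL `0`, THE DIRECT WORD).  For ANY transport root `r ∈ box`, in-block kernel root `toSite rb`, `1 ≤ Lc`, all units, any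
`cE`, any axes, any cell bond `c`, ANY local `S′` with zero ff block:
`Σ'_{u′} Σ'_{(y,w)} 𝟙f(y_α)𝟙f(w_β)·((vertexOfK X̃♮_0 Lc (unitS (𝒯S′)) μ c ∘ X̃♮_0) ∘ vertexOfK X̃♮_0 Lc (unitS (𝒯(cE • wilsonA))) ν u′) y w (inl α)(inl β) = 0` (`𝒯S κ u := Ψ̂ᵀ∘slotPsiS r Lc S κ u∘Ψ̂`)
— `TransportedWordReduction.tsum_transported_direct_word_eq_zero_of_current` with the product-form Wilson current (§1: periodic, hence bounded, killed). -/
theorem tsum_transported_noFF_wilson_word_eq_zero (hLc : 1 ≤ Lc) (hrb : rb ∈ box (d + 1) Lc) (hr : r ∈ box (d + 1) Lc) (sf sm cE : ℝ) (hS : LocStencil S' Cs δs) (hδs : 0 < δs)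
    (hSff : ∀ (κ' : Fin (d + 1)) (t x z : Site (d + 1)) (α' a : Fin (d + 1)), S' κ' t x z (Sum.inl α') (Sum.inl a) = 0) (c : Site (d + 1)) :
    ∑' u' : Site (d + 1), ∑' yw : Site (d + 1) × Site (d + 1), (if yw.1 α % (Lc : ℤ) = (Lc : ℤ) - 1 then (1 : ℝ) else 0) * (if yw.2 β % (Lc : ℤ) = (Lc : ℤ) - 1 then (1 : ℝ) else 0) *
        comp (comp (vertexOfK (unitK sf sm (coDressKBmAt (toSite rb) Lc (KInvStep (d := d) Lc 0))) Lc
            (unitS sf sm (fun κ u => comp (comp (trK (psiKS r Lc)) (slotPsiS r Lc S' κ u)) (psiKS r Lc))) μ c)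
          (unitK sf sm (coDressKBmAt (toSite rb) Lc (KInvStep (d := d) Lc 0))))
          (vertexOfK (unitK sf sm (coDressKBmAt (toSite rb) Lc (KInvStep (d := d) Lc 0))) Lc
            (unitS sf sm (fun κ u => comp (comp (trK (psiKS r Lc)) (slotPsiS r Lc (fun κ v => cE • wilsonA d κ v) κ u)) (psiKS r Lc))) ν u')
          yw.1 yw.2 (Sum.inl α) (Sum.inl β) = 0 := by
  set t : Fin (d + 1) → Site (d + 1) → ℝ := fun b z => ∑' uw : Site (d + 1) × Site (d + 1), (if uw.2 β % (Lc : ℤ) = (Lc : ℤ) - 1 then (1 : ℝ) else 0) *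
    vertexOfK (unitK sf sm (coDressKBmAt (toSite rb) Lc (KInvStep (d := d) Lc 0))) Lc (unitS sf sm (fun κ v => cE • wilsonA d κ v)) ν uw.1 z uw.2 (Sum.inl b) (Sum.inl β) with ht
  have hper : ∀ (b : Fin (d + 1)) (z s : Site (d + 1)), t b (z + (Lc : ℤ) • s) = t b z := fun b z s => by
    simp only [ht]
    exact wilsonCurrent_periodic (rb := rb) hLc sf sm cE 0 ν β (Sum.inl b) (Sum.inl β) z s
  exact tsum_transported_direct_word_eq_zero_of_current hLc hrb hr sf sm 0 hS hδs hSff (locStencil_smul cE (locStencil_wilsonA (d := d) zero_le_one)) one_pos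
    (fun κ' t x z m => wilson_inr_inl cE β κ' t x z m) c (t := t) (fun b z => by simp only [ht]) (fun b z => current_bounded (Lc := Lc) hper b z) hper
    (fun y₁ m => by simp only [ht]; exact tsum_dressedStep_zero_inr_mul_wilsonCurrent hLc hrb sf sm cE ν β y₁ m)

/-- NOT IN PRINT; OUR BOOKKEEPING ([folklore]; (24) AT THE COMB DATA, LEVEL `0`, THE SWAP WORD).  Same data:
`Σ'_{u′} Σ'_{(y,w)} 𝟙f(y_α)𝟙f(w_β)·((vertexOfK X̃♮_0 Lc (unitS (𝒯(cE • wilsonA))) ν u′ ∘ X̃♮_0) ∘ vertexOfK X̃♮_0 Lc (unitS (𝒯S′)) μ c) y w (inl α)(inl β) = 0`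
— `TransportedWordReduction.tsum_transported_swap_word_eq_zero_of_current` with the `α`-read product-form Wilson current and the leg antisymmetry of the Wilson table. -/
theorem tsum_transported_wilson_noFF_word_eq_zero (hLc : 1 ≤ Lc) (hrb : rb ∈ box (d + 1) Lc) (hr : r ∈ box (d + 1) Lc) (sf sm cE : ℝ) (hS : LocStencil S' Cs δs) (hδs : 0 < δs)
    (hSff : ∀ (κ' : Fin (d + 1)) (t x z : Site (d + 1)) (α' a : Fin (d + 1)), S' κ' t x z (Sum.inl α') (Sum.inl a) = 0) (c : Site (d + 1)) :
    ∑' u' : Site (d + 1), ∑' yw : Site (d + 1) × Site (d + 1), (if yw.1 α % (Lc : ℤ) = (Lc : ℤ) - 1 then (1 : ℝ) else 0) * (if yw.2 β % (Lc : ℤ) = (Lc : ℤ) - 1 then (1 : ℝ) else 0) *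
        comp (comp (vertexOfK (unitK sf sm (coDressKBmAt (toSite rb) Lc (KInvStep (d := d) Lc 0))) Lc
            (unitS sf sm (fun κ u => comp (comp (trK (psiKS r Lc)) (slotPsiS r Lc (fun κ v => cE • wilsonA d κ v) κ u)) (psiKS r Lc))) ν u')
          (unitK sf sm (coDressKBmAt (toSite rb) Lc (KInvStep (d := d) Lc 0))))
          (vertexOfK (unitK sf sm (coDressKBmAt (toSite rb) Lc (KInvStep (d := d) Lc 0))) Lc
            (unitS sf sm (fun κ u => comp (comp (trK (psiKS r Lc)) (slotPsiS r Lc S' κ u)) (psiKS r Lc))) μ c)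
          yw.1 yw.2 (Sum.inl α) (Sum.inl β) = 0 := by
  set t' : Fin (d + 1) → Site (d + 1) → ℝ := fun b z => ∑' uy : Site (d + 1) × Site (d + 1), (if uy.2 α % (Lc : ℤ) = (Lc : ℤ) - 1 then (1 : ℝ) else 0) *
    vertexOfK (unitK sf sm (coDressKBmAt (toSite rb) Lc (KInvStep (d := d) Lc 0))) Lc (unitS sf sm (fun κ v => cE • wilsonA d κ v)) ν uy.1 z uy.2 (Sum.inl b) (Sum.inl α) with ht'
  have hper : ∀ (b : Fin (d + 1)) (z s : Site (d + 1)), t' b (z + (Lc : ℤ) • s) = t' b z := fun b z s => by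
    simp only [ht']
    exact wilsonCurrent_periodic (rb := rb) hLc sf sm cE 0 ν α (Sum.inl b) (Sum.inl α) z s
  exact tsum_transported_swap_word_eq_zero_of_current hLc hrb hr sf sm 0 hS hδs hSff (locStencil_smul cE (locStencil_wilsonA (d := d) zero_le_one)) one_pos
    (fun κ' u x z a b => wilson_antisymm cE κ' u x z a b) (fun κ' t x z m => wilson_inr_inl cE α κ' t x z m) c (t' := t') (fun b z => by simp only [ht'])
    (fun b z => current_bounded (Lc := Lc) hper b z) hper (fun y₁ m => by simp only [ht']; exact tsum_dressedStep_zero_inr_mul_wilsonCurrent hLc hrb sf sm cE ν α y₁ m)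

/-- NOT IN PRINT; OUR BOOKKEEPING ([folklore]; IN THE ZERO MODE).  Both cell-and-lattice sums `Σ_{c ∈ box N} Σ'_{u′}` of the two level-`0` words over transported tables vanish. -/
theorem sum_box_transported_noFF_wilson_words_eq_zero (hLc : 1 ≤ Lc) (hrb : rb ∈ box (d + 1) Lc) (hr : r ∈ box (d + 1) Lc) (sf sm cE : ℝ) (hS : LocStencil S' Cs δs) (hδs : 0 < δs)
    (hSff : ∀ (κ' : Fin (d + 1)) (t x z : Site (d + 1)) (α' a : Fin (d + 1)), S' κ' t x z (Sum.inl α') (Sum.inl a) = 0) (N : ℕ) :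
    (∑ c ∈ box (d + 1) N, ∑' u' : Site (d + 1), ∑' yw : Site (d + 1) × Site (d + 1), (if yw.1 α % (Lc : ℤ) = (Lc : ℤ) - 1 then (1 : ℝ) else 0) * (if yw.2 β % (Lc : ℤ) = (Lc : ℤ) - 1 then (1 : ℝ) else 0) *
        comp (comp (vertexOfK (unitK sf sm (coDressKBmAt (toSite rb) Lc (KInvStep (d := d) Lc 0))) Lc
            (unitS sf sm (fun κ u => comp (comp (trK (psiKS r Lc)) (slotPsiS r Lc S' κ u)) (psiKS r Lc))) μ (toSite c))
          (unitK sf sm (coDressKBmAt (toSite rb) Lc (KInvStep (d := d) Lc 0))))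
          (vertexOfK (unitK sf sm (coDressKBmAt (toSite rb) Lc (KInvStep (d := d) Lc 0))) Lc
            (unitS sf sm (fun κ u => comp (comp (trK (psiKS r Lc)) (slotPsiS r Lc (fun κ v => cE • wilsonA d κ v) κ u)) (psiKS r Lc))) ν u')
          yw.1 yw.2 (Sum.inl α) (Sum.inl β) = 0) ∧
    (∑ c ∈ box (d + 1) N, ∑' u' : Site (d + 1), ∑' yw : Site (d + 1) × Site (d + 1), (if yw.1 α % (Lc : ℤ) = (Lc : ℤ) - 1 then (1 : ℝ) else 0) * (if yw.2 β % (Lc : ℤ) = (Lc : ℤ) - 1 then (1 : ℝ) else 0) *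
        comp (comp (vertexOfK (unitK sf sm (coDressKBmAt (toSite rb) Lc (KInvStep (d := d) Lc 0))) Lc
            (unitS sf sm (fun κ u => comp (comp (trK (psiKS r Lc)) (slotPsiS r Lc (fun κ v => cE • wilsonA d κ v) κ u)) (psiKS r Lc))) ν u')
          (unitK sf sm (coDressKBmAt (toSite rb) Lc (KInvStep (d := d) Lc 0))))
          (vertexOfK (unitK sf sm (coDressKBmAt (toSite rb) Lc (KInvStep (d := d) Lc 0))) Lc
            (unitS sf sm (fun κ u => comp (comp (trK (psiKS r Lc)) (slotPsiS r Lc S' κ u)) (psiKS r Lc))) μ (toSite c))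
          yw.1 yw.2 (Sum.inl α) (Sum.inl β) = 0) :=
  ⟨Finset.sum_eq_zero fun c _ => tsum_transported_noFF_wilson_word_eq_zero (μ := μ) (ν := ν) (α := α) (β := β) hLc hrb hr sf sm cE hS hδs hSff (toSite c),
    Finset.sum_eq_zero fun c _ => tsum_transported_wilson_noFF_word_eq_zero (μ := μ) (ν := ν) (α := α) (β := β) hLc hrb hr sf sm cE hS hδs hSff (toSite c)⟩

end LevelZero

/-! ## §3 At the comb data: an1's sym border, the comb root, level `0` of the comb tower -/

section Comb

variable {μ ν α β : Fin (d + 1)}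

/-- NOT IN PRINT; OUR BOOKKEEPING ([folklore]; (24)_comb AT LEVEL `0`, F6 `CombForcingSectorSplit.dM_comb_zero_split`'s sectors `V^VH′ ⊗ V^{E,0}′` and the swap).  At the comb root
`ρ_c = ctr (d+1) Lc` (`= toSite (ctrOff (d+1) Lc)`, `rfl`), transport `𝒯 = Ψ̂_Sᵀ∘slotPsiS (ctrOff) Lc∘Ψ̂_S`, all units, any `cE`, any border weight `c` (`= cVH` at level `0`; an1's border
`S^VH_c = c • symVhSAt ρ_c`, no ff block by F3 `symVhS_inl_inl`), every period `N`, all axes: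
`Σ_{cb ∈ box N} Σ'_{u′} FF[(vertexOfK X̃_0 Lc (unitS (𝒯 S^VH_c)) μ cb ∘ X̃_0) ∘ vertexOfK X̃_0 Lc (unitS (𝒯(cE • wilsonA))) ν u′] = 0` and the swap — §2 at `r = rb = ctrOff (d+1) Lc`. -/
theorem sum_box_comb_symVhS_wilson_words_zero_eq_zero (sf sm cE c : ℝ) (N : ℕ) :
    (∑ cb ∈ box (d + 1) N, ∑' u' : Site (d + 1), ∑' yw : Site (d + 1) × Site (d + 1),
        (if yw.1 α % (Lc : ℤ) = (Lc : ℤ) - 1 then (1 : ℝ) else 0) * (if yw.2 β % (Lc : ℤ) = (Lc : ℤ) - 1 then (1 : ℝ) else 0) *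
        comp (comp (vertexOfK (unitK sf sm (coDressKBmAt (ctr (d + 1) Lc) Lc (KInvStep (d := d) Lc 0))) Lc
            (unitS sf sm (fun κ v => comp (comp (trK (psiKS (ctrOff (d + 1) Lc) Lc))
              (slotPsiS (ctrOff (d + 1) Lc) Lc (fun κ v => c • symVhSAt (ctr (d + 1) Lc) d Lc rfl κ v) κ v)) (psiKS (ctrOff (d + 1) Lc) Lc))) μ (toSite cb))
          (unitK sf sm (coDressKBmAt (ctr (d + 1) Lc) Lc (KInvStep (d := d) Lc 0))))
          (vertexOfK (unitK sf sm (coDressKBmAt (ctr (d + 1) Lc) Lc (KInvStep (d := d) Lc 0))) Lc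
            (unitS sf sm (fun κ v => comp (comp (trK (psiKS (ctrOff (d + 1) Lc) Lc))
              (slotPsiS (ctrOff (d + 1) Lc) Lc (fun κ v => cE • wilsonA d κ v) κ v)) (psiKS (ctrOff (d + 1) Lc) Lc))) ν u')
          yw.1 yw.2 (Sum.inl α) (Sum.inl β) = 0) ∧
    (∑ cb ∈ box (d + 1) N, ∑' u' : Site (d + 1), ∑' yw : Site (d + 1) × Site (d + 1),
        (if yw.1 α % (Lc : ℤ) = (Lc : ℤ) - 1 then (1 : ℝ) else 0) * (if yw.2 β % (Lc : ℤ) = (Lc : ℤ) - 1 then (1 : ℝ) else 0) *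
        comp (comp (vertexOfK (unitK sf sm (coDressKBmAt (ctr (d + 1) Lc) Lc (KInvStep (d := d) Lc 0))) Lc
            (unitS sf sm (fun κ v => comp (comp (trK (psiKS (ctrOff (d + 1) Lc) Lc))
              (slotPsiS (ctrOff (d + 1) Lc) Lc (fun κ v => cE • wilsonA d κ v) κ v)) (psiKS (ctrOff (d + 1) Lc) Lc))) ν u')
          (unitK sf sm (coDressKBmAt (ctr (d + 1) Lc) Lc (KInvStep (d := d) Lc 0))))
          (vertexOfK (unitK sf sm (coDressKBmAt (ctr (d + 1) Lc) Lc (KInvStep (d := d) Lc 0))) Lc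
            (unitS sf sm (fun κ v => comp (comp (trK (psiKS (ctrOff (d + 1) Lc) Lc))
              (slotPsiS (ctrOff (d + 1) Lc) Lc (fun κ v => c • symVhSAt (ctr (d + 1) Lc) d Lc rfl κ v) κ v)) (psiKS (ctrOff (d + 1) Lc) Lc))) μ (toSite cb))
          yw.1 yw.2 (Sum.inl α) (Sum.inl β) = 0) := by
  have hLc : 1 ≤ Lc := Nat.one_le_iff_ne_zero.mpr (NeZero.ne Lc)
  exact sum_box_transported_noFF_wilson_words_eq_zero (μ := μ) (ν := ν) (α := α) (β := β) hLc (ctrOff_mem_box pos_Lc) (ctrOff_mem_box pos_Lc) sf sm cE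
    (locStencil_symVhS (Lc := Lc) c zero_le_one) one_pos (fun κ' t x z α' a => symVhS_inl_inl (Lc := Lc) c κ' t x z α' a) N

end Comb

end Summit.QuantumFields.BalabanUV.Beta.GAN24.CombVHEWordsZero

end
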